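import Summits.QuantumFields.YangMills.Theorems.UnitScaleTiltProp7InterpErrorLocalLaplaceEnergy
import Summits.QuantumFields.YangMills.Theorems.UnitScaleTiltProp7InterpErrorHarmonicLetters
import Summits.QuantumFields.YangMills.Theorems.UnitScaleTiltProp7GreenKernelSiteFreeLaplace
import Summits.QuantumFields.YangMills.Theorems.UnitScaleTiltProp7PinnedKernelGeometry
import HarnessLib

/-!
# Route `UnitScaleTilt`, crux K1 «MinimiserStabilityRegPr» (stmt-QuantumFields-19200), route-R E′ path (α′), (E1-b), row (hK₂-W) — FILE 2b:
# THE PIN REACTION — `|Δ²φ_H(y₀)| ≤ C_q·c²·ℓ·sup|Δφ|` at every centre `y₀` (`d = 3`, `ℓ = L^k ≥ 1024`), with the local mass of `Δφ_H`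

Cell `ym3-torus`, width seat `ym3-torus-px7` (gen 3), LOCATE 19200 evidence `LOCATE-HK2W-HARMONIC-px7g3.md` §2 (Q)(PIN); FILE 1 ✓ `…InterpErrorLocalLaplaceEnergy`
(p669609), FILE 2a ✓ `…InterpErrorHarmonicLetters` (p670170).  `--supports stmt-QuantumFields-19200`, count-neutral.  THEOREMS ONLY (0 `def`, 0 `sorry`).
YM₃ on T³ is a ladder rung (R3), not the Clay problem; nothing here claims the stub, the crux, d = 4 or the gap.

THE POINT (px4 g2's PIN CONE, as a theorem).  `V := Δφ_H` is harmonic off the centres; at a centre `y₀` it has the isolated singularity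
`(q₀∕(2c²))·G̃(EK y₀ − EK ·)`, `q₀ := (ΔV)(y₀)` the PIN REACTION.  (Q): testing `ΔV` against the scale cutoff `χ` (✓ `exists_scale_cutoff`, `χ = 1`
near `y₀`, `|Δχ| ≤ 27c²∕ℓ_χ²`, no other centre in its support) gives `q₀ = Σχ·ΔV = Σ(Δχ)·V`, so `|q₀| ≤ (27c²∕ℓ_χ²)·√#ball·√Σ_{ball}V² ≍ c²·ℓ⁻²·ℓ^{3∕2}·ℓ^{3∕2} = c²ℓ`
by the local energy (FILE 1).  The near row built on `q₀` is the next file.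

WHAT IS PROVED (ns `…Theorems.Prop7InterpErrorPinReaction`; `P.d = 3`, `j = 0`, `k ≤ m + K`, `c ≠ 0`, `φ_H` = pinned interpolant of `φ` on `range (embIter k)`
biharmonic off it, `|Δφ| ≤ M`; `q := L^k ∕ 1024` (integer division), `n₁ := 13q + 18`).
* §1 `scales` (integer bookkeeping of `q`, `n₁` against `L^k ≥ 1024`), `card_ball_le` (`#{tdist ≤ R} ≤ 216ℓ³` for `R ≤ ℓ`),
  ★ `sum_ball_sq_laplace_interp_le` ((V-loc): `R ≤ L^k ⇒ Σ_{tdist(z,x₀)≤R}(Δφ_H z)² ≤ C_V·(L^k)³·M²`, over FILE 1).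
* §2 ★★ `abs_pin_reaction_le` ((Q): `L^k ≥ 1024 ⇒ |Δ(Δφ_H)(embIter k y₀)| ≤ C_q·c²·L^k·M`).
All constants absolute (no `c`, `L`, `k`, volume).  HONEST SCOPE.  Flat letters; the near row is FILE 2b′ (`…InterpErrorNearRow`), the far row and the assembly FILE 2c.

References: T. Bałaban, CMP 96 (1984) 223–250 [Balaban1984PropagatorsII] ((1.9) p.226); CMP 99 (1985) 75–102 [Balaban1985RegularSpaces] ((1.36) p.82);
CMP 102 (1985) 277–309 [Balaban1985Variational] (Prop. 7 p.299); G. F. Lawler, V. Limic, *Random Walk: A Modern Introduction* (2010), Thm 4.3.1 [LawlerLimic2010].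
-/

set_option autoImplicit false

noncomputable section

open scoped BigOperators

namespace Summit.QuantumFields.YangMills.Theorems.Prop7InterpErrorPinReaction

open Literature.MathematicalPhysics.QuantumFieldTheory.Balaban1983to89
open Finset
open LatticeFieldCalculus (laplace)
open B15DeterminingSets (embIter)
open B3Taylor310LocalRemainder (tdist_comm tdist_self)
open B5Eq117TorusCarriers (EK)
open Literature.Probability.LatticeModels (torusGreen TorusSite)
open Summit.QuantumFields.YangMills.Theorems.Prop7CentreHarmonicInterpKernel (laplace_sub')
open Summit.QuantumFields.YangMills.Theorems.Prop7GreenKernelSiteTransport (laplace_one_const_mul)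
open Summit.QuantumFields.YangMills.Theorems.Prop7GreenKernelSiteFreeLaplace (laplace_one_torusGreen_EK_sub)
open Summit.QuantumFields.YangMills.Theorems.Prop7PinnedHodgeSplit (sum_mul_laplace_comm)
open Summit.QuantumFields.YangMills.Theorems.Prop7TorusAgmonWeight (exists_scale_cutoff)
open Summit.QuantumFields.YangMills.Theorems.Prop7PinnedKernelGeometry (card_filter_tdist_lt_le pow_le_tdist_embIter_of_ne locally_const_of_cutoff)
open Summit.QuantumFields.YangMills.Theorems.Prop7InterpErrorLocalLaplaceEnergy (sum_ball_sq_laplace_interp_error_le_T3)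
open Summit.QuantumFields.YangMills.Theorems.Prop7InterpErrorHarmonicLetters (laplace_eq_sq_mul_laplace_one sq_le_of_laplace_one_eq_const
  sum_ball_sq_torusGreen_EK_le abs_torusGreen_EK_sub_mul_tdist_le)

/-! ## §1 Scales, the period, and the local mass of `Δφ_H` -/

/-- integer bookkeeping of the two scales `q = L^k∕1024 ≥ 1`, `n₁ = 13q + 18` against `ℓ = L^k`. [folklore] -/
theorem scales {ℓ : ℕ} (hℓ : 1024 ≤ ℓ) :
    1 ≤ ℓ / 1024 ∧ 1024 * (ℓ / 1024) ≤ ℓ ∧ ℓ ≤ 1024 * (ℓ / 1024) + 1023 ∧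
      9 * (13 * (ℓ / 1024) + 18) + 1 ≤ ℓ ∧ 15 * (13 * (ℓ / 1024) + 18) + 21 < ℓ ∧ ℓ ≤ 158 * (13 * (ℓ / 1024) + 18) ∧
      13 * (ℓ / 1024) + 18 ≤ ℓ ∧ 11 * (13 * (ℓ / 1024) + 18) < 2 * ℓ ∧ 12 * (ℓ / 1024) + 18 ≤ ℓ ∧ 8 * (ℓ / 1024) + 12 < 2 * ℓ := by
  omega

variable {P : Params}

/-- the number of sites of a `tdist`-ball of radius `R ≤ ℓ` (`ℓ ≥ 1`, `d = 3`) is at most `216ℓ³`. [folklore] -/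
theorem card_ball_le [DecidableEq (Site P 0)] (hd : P.d = 3) (b : Site P 0) {R ℓ : ℝ} (hR0 : 0 ≤ R) (hR : R ≤ ℓ) (hℓ : 1 ≤ ℓ) :
    ((Finset.univ.filter fun z : Site P 0 => (Site.tdist z b : ℝ) ≤ R).card : ℝ) ≤ 216 * ℓ ^ 3 := by
  classical
  have h1 : (Finset.univ.filter fun z : Site P 0 => (Site.tdist z b : ℝ) ≤ R).card
      ≤ (Finset.univ.filter fun z : Site P 0 => (Site.tdist z b : ℝ) < R + 1).card :=
    Finset.card_le_card fun z hz => by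
      rw [Finset.mem_filter] at hz ⊢; exact ⟨hz.1, by linarith [hz.2]⟩
  have h2 := card_filter_tdist_lt_le b R
  rw [hd] at h2
  have hceil : (⌈R⌉₊ : ℝ) < R + 1 := Nat.ceil_lt_add_one hR0
  calc ((Finset.univ.filter fun z : Site P 0 => (Site.tdist z b : ℝ) ≤ R).card : ℝ)
      ≤ ((2 * (⌈R⌉₊ + 1)) ^ 3 : ℕ) := by exact_mod_cast h1.trans h2
    _ = (2 * ((⌈R⌉₊ : ℝ) + 1)) ^ 3 := by push_cast; ring
    _ ≤ (2 * (3 * ℓ)) ^ 3 := by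
        refine pow_le_pow_left₀ (by positivity) ?_ 3
        nlinarith
    _ = 216 * ℓ ^ 3 := by ring

/-- ★ **(V-loc) THE LOCAL MASS OF `Δφ_H`**: there is an absolute `C_V > 0` with `Σ_{tdist(z,x₀) ≤ R} (Δφ_H(z))² ≤ C_V·(L^k)³·M²` for every `0 ≤ R ≤ L^k`
(`Δφ_H = Δφ − Δ(φ − φ_H)`: the first piece is `≤ 216ℓ³·M²` by counting, the second is FILE 1 ✓ `sum_ball_sq_laplace_interp_error_le_T3` with `e^{R∕ℓ} ≤ e`).
[cite: Balaban1984PropagatorsII, (1.9) p.226; Balaban1985Variational, Prop. 7 p.299] -/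
theorem sum_ball_sq_laplace_interp_le : ∃ CV : ℝ, 0 < CV ∧
    ∀ (P : Params) (_ : P.d = 3) (k : ℕ) (_ : k ≤ P.m + P.K) (c : ℝ) (_ : c ≠ 0) (x₀ : Site P 0) (R : ℝ) (_ : 0 ≤ R)
      (_ : R ≤ (P.L : ℝ) ^ k) (φ φH : SiteField P 0 ℝ) (_ : ∀ x ∈ Set.range (embIter k), φH x = φ x)
      (_ : ∀ x ∉ Set.range (embIter k), laplace c (laplace c φH) x = 0) (M : ℝ) (_ : ∀ z, |laplace c φ z| ≤ M),
      ∑ z ∈ Finset.univ.filter (fun z : Site P 0 => (Site.tdist z x₀ : ℝ) ≤ R), (laplace c φH z) ^ 2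
        ≤ CV * ((P.L : ℝ) ^ k) ^ 3 * M ^ 2 := by
  obtain ⟨CE, hCE, hE⟩ := sum_ball_sq_laplace_interp_error_le_T3
  refine ⟨432 + 2 * Real.exp 1 * CE, by positivity, ?_⟩
  intro P hd k hk c hc x₀ R hR0 hR φ φH hH hEL M hφ
  classical
  set ℓ : ℝ := (P.L : ℝ) ^ k with hℓdef
  have hL1 : (1 : ℝ) ≤ (P.L : ℝ) := by exact_mod_cast P.L_pos
  have hℓ : 1 ≤ ℓ := one_le_pow₀ hL1
  have hℓ0 : 0 < ℓ := by linarith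
  have hM : 0 ≤ M := (abs_nonneg _).trans (hφ x₀)
  set B := Finset.univ.filter (fun z : Site P 0 => (Site.tdist z x₀ : ℝ) ≤ R) with hB
  -- pointwise split
  have hpt : ∀ z, (laplace c φH z) ^ 2 ≤ 2 * M ^ 2 + 2 * (laplace c (fun x => φ x - φH x) z) ^ 2 := by
    intro z
    have e : laplace c φH z = laplace c φ z - laplace c (fun x => φ x - φH x) z := by
      rw [laplace_sub']; ring
    rw [e]
    have h1 : (laplace c φ z) ^ 2 ≤ M ^ 2 := by
      have := hφ z; rw [← sq_abs]; exact pow_le_pow_left₀ (abs_nonneg _) this 2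
    nlinarith [sq_nonneg (laplace c φ z + laplace c (fun x => φ x - φH x) z)]
  have hcard := card_ball_le hd x₀ hR0 hR hℓ
  have hF1 := hE P hd k hk c hc x₀ R hR0 φ φH hH hEL M hφ
  have hexp : Real.exp (R / ℓ) ≤ Real.exp 1 := Real.exp_le_exp.2 ((div_le_one hℓ0).2 hR)
  calc ∑ z ∈ B, (laplace c φH z) ^ 2 ≤ ∑ z ∈ B, (2 * M ^ 2 + 2 * (laplace c (fun x => φ x - φH x) z) ^ 2) :=
        Finset.sum_le_sum fun z _ => hpt z
    _ = (B.card : ℝ) * (2 * M ^ 2) + 2 * ∑ z ∈ B, (laplace c (fun x => φ x - φH x) z) ^ 2 := by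
        rw [Finset.sum_add_distrib, Finset.sum_const, nsmul_eq_mul, Finset.mul_sum]
    _ ≤ 216 * ℓ ^ 3 * (2 * M ^ 2) + 2 * (CE * Real.exp (R / ℓ) * ℓ ^ 3 * M ^ 2) := by
        refine add_le_add (mul_le_mul_of_nonneg_right hcard (by positivity)) (mul_le_mul_of_nonneg_left hF1 (by norm_num))
    _ ≤ 216 * ℓ ^ 3 * (2 * M ^ 2) + 2 * (CE * Real.exp 1 * ℓ ^ 3 * M ^ 2) := by
        have : CE * Real.exp (R / ℓ) * ℓ ^ 3 * M ^ 2 ≤ CE * Real.exp 1 * ℓ ^ 3 * M ^ 2 := by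
          have h0 : 0 ≤ CE * ℓ ^ 3 * M ^ 2 := by positivity
          nlinarith
        linarith
    _ = (432 + 2 * Real.exp 1 * CE) * ℓ ^ 3 * M ^ 2 := by ring

/-! ## §2 ★★ (Q) The pin reaction -/

/-- `5√3 ≤ 9`. [folklore] -/
theorem five_sqrt_three_le : 5 * Real.sqrt 3 ≤ 9 := by
  nlinarith [Real.sq_sqrt (show (0 : ℝ) ≤ 3 by norm_num), Real.sqrt_nonneg 3]

/-- the Laplacian of a site function vanishes where the function is locally constant. [folklore] -/
theorem laplace_eq_zero_of_locally_const {j : ℕ} (c : ℝ) (χ : SiteField P j ℝ) (z : Site P j)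
    (h : ∀ μ, χ (z.shift μ) = χ z ∧ χ (z.unshift μ) = χ z) : laplace c χ z = 0 := by
  simp only [laplace, smul_eq_mul]
  refine Finset.sum_eq_zero fun μ _ => ?_
  rw [(h μ).1, (h μ).2]; ring

/-- ★★ **(Q) THE PIN REACTION IS `O(c²·ℓ·sup|Δφ|)`**: there is an absolute `C_q > 0` such that, for `L^k ≥ 1024` and every centre `y₀`,
`|Δ(Δφ_H)(embIter k y₀)| ≤ C_q·c²·L^k·M` (test `ΔV`, `V := Δφ_H`, against the scale cutoff `χ` at `y₀` of scale `n₁ = 13(L^k∕1024) + 18`: the only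
centre in `supp χ` is `y₀`, so `Σχ·ΔV = (ΔV)(y₀)`; summation by parts; `|Δχ| ≤ 27c²∕n₁²`, Cauchy–Schwarz on the ball of radius `9n₁+1 ≤ L^k`, (V-loc)).
[cite: Balaban1985Variational, Prop. 7 p.299; Balaban1984PropagatorsII, (1.9) p.226] -/
theorem abs_pin_reaction_le : ∃ Cq : ℝ, 0 < Cq ∧
    ∀ (P : Params) (_ : P.d = 3) (k : ℕ) (hk : k ≤ P.m + P.K) (c : ℝ) (_ : c ≠ 0) (_ : 1024 ≤ P.L ^ k)
      (φ φH : SiteField P 0 ℝ) (_ : ∀ x ∈ Set.range (embIter k), φH x = φ x)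
      (_ : ∀ x ∉ Set.range (embIter k), laplace c (laplace c φH) x = 0) (M : ℝ) (_ : ∀ z, |laplace c φ z| ≤ M) (y₀ : Site P k),
      |laplace c (laplace c φH) (embIter k y₀)| ≤ Cq * c ^ 2 * (P.L : ℝ) ^ k * M := by
  obtain ⟨CV, hCV, hV⟩ := sum_ball_sq_laplace_interp_le
  refine ⟨27 * Real.sqrt 216 * Real.sqrt CV * 158 ^ 2, by positivity, ?_⟩
  intro P hd k hk c hc hℓk φ φH hH hEL M hφ y₀
  classical
  obtain ⟨hq1, hq2, hq3, h9, h15, h158, hn1ℓ, h11, h12, h8⟩ := scales hℓk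
  set q : ℕ := P.L ^ k / 1024 with hq
  set n₁ : ℕ := 13 * q + 18 with hn₁
  set ℓ : ℝ := (P.L : ℝ) ^ k with hℓdef
  have hℓN : ((P.L ^ k : ℕ) : ℝ) = ℓ := by push_cast; rfl
  have hL1 : (1 : ℝ) ≤ (P.L : ℝ) := by exact_mod_cast P.L_pos
  have hℓ1 : 1 ≤ ℓ := one_le_pow₀ hL1
  have hM : 0 ≤ M := (abs_nonneg _).trans (hφ (embIter k y₀))
  have hn₁1 : (1 : ℝ) ≤ (n₁ : ℝ) := by rw [hn₁]; push_cast; linarith [(Nat.cast_nonneg q : (0:ℝ) ≤ q)]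
  have hn₁0 : (0 : ℝ) < n₁ := by linarith
  have h9ℓ : 9 * (n₁ : ℝ) + 1 ≤ ℓ := by rw [← hℓN]; exact_mod_cast h9
  have h158ℓ : ℓ ≤ 158 * (n₁ : ℝ) := by rw [← hℓN]; exact_mod_cast h158
  set y₀' : Site P 0 := embIter k y₀ with hy₀'
  set V : SiteField P 0 ℝ := laplace c φH with hVdef
  -- the cutoff
  obtain ⟨χ, hχ01, hin, hout, -, -, -, hlapχ⟩ := exists_scale_cutoff y₀' hn₁1
  have hd3 : (P.d : ℝ) = 3 := by exact_mod_cast hd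
  have hout' : ∀ z, 9 * (n₁ : ℝ) ≤ (Site.tdist z y₀' : ℝ) → χ z = 0 := fun z hz =>
    hout z (le_trans (by rw [hd3]; nlinarith [five_sqrt_three_le]) hz)
  -- LHS of the summation by parts: only the centre `y₀` survives
  have hLHS : ∑ x, χ x * laplace c V x = laplace c V y₀' := by
    rw [Finset.sum_eq_single y₀']
    · rw [hin y₀' (by rw [hy₀', tdist_self]; exact_mod_cast Nat.zero_le _), one_mul]
    · intro x _ hx
      by_cases hxC : x ∈ Set.range (embIter k)
      · obtain ⟨y, rfl⟩ := hxC
        have hne : y ≠ y₀ := fun h => hx (by rw [h])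
        have ht : (P.L ^ k : ℝ) ≤ Site.tdist (embIter k y) y₀' := by
          rw [hy₀']; exact_mod_cast pow_le_tdist_embIter_of_ne hk hne
        rw [hout' _ (by linarith), zero_mul]
      · rw [hVdef, hEL x hxC, mul_zero]
    · intro h; exact absurd (Finset.mem_univ _) h
  have hparts : laplace c V y₀' = ∑ x, laplace c χ x * V x := by rw [← hLHS, sum_mul_laplace_comm]
  -- RHS: `Δχ` lives on the ball of radius `9n₁ + 1`
  set B := Finset.univ.filter (fun z : Site P 0 => (Site.tdist z y₀' : ℝ) ≤ 9 * n₁ + 1) with hB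
  have hzero : ∀ x ∉ B, laplace c χ x * V x = 0 := by
    intro x hx
    rw [hB, Finset.mem_filter, not_and] at hx
    have hx' : 9 * (n₁ : ℝ) + 1 < Site.tdist x y₀' := lt_of_not_ge (hx (Finset.mem_univ _))
    rw [laplace_eq_zero_of_locally_const c χ x fun μ => locally_const_of_cutoff χ y₀' hin hout x (Or.inr ?_) μ, zero_mul]
    rw [hd3]; nlinarith [five_sqrt_three_le]
  have hRHS : ∑ x, laplace c χ x * V x = ∑ x ∈ B, laplace c χ x * V x :=
    (Finset.sum_subset (Finset.subset_univ B) fun x _ hx => hzero x hx).symm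
  -- Cauchy–Schwarz on the ball
  have hlap : ∀ x, |laplace c χ x| ≤ 27 * c ^ 2 / (n₁ : ℝ) ^ 2 := by
    intro x
    have := hlapχ c x
    rw [hd3] at this
    calc |laplace c χ x| ≤ 9 * 3 * c ^ 2 / (n₁ : ℝ) ^ 2 := this
      _ = 27 * c ^ 2 / (n₁ : ℝ) ^ 2 := by ring
  have hCS : ∑ x ∈ B, |V x| ≤ Real.sqrt (B.card : ℝ) * Real.sqrt (∑ x ∈ B, V x ^ 2) := by
    have h := Real.sum_mul_le_sqrt_mul_sqrt B (fun _ => (1 : ℝ)) (fun x => |V x|)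
    simp only [one_mul, one_pow, Finset.sum_const, nsmul_eq_mul, mul_one, sq_abs] at h
    exact h
  have hcardB : (B.card : ℝ) ≤ 216 * ℓ ^ 3 := card_ball_le hd y₀' (by positivity) h9ℓ hℓ1
  have hVB : ∑ x ∈ B, V x ^ 2 ≤ CV * ℓ ^ 3 * M ^ 2 := hV P hd k hk c hc y₀' (9 * n₁ + 1) (by positivity) h9ℓ φ φH hH hEL M hφ
  have hbound : |laplace c V y₀'| ≤ 27 * c ^ 2 / (n₁ : ℝ) ^ 2 * (Real.sqrt (216 * ℓ ^ 3) * Real.sqrt (CV * ℓ ^ 3 * M ^ 2)) := by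
    rw [hparts, hRHS]
    calc |∑ x ∈ B, laplace c χ x * V x| ≤ ∑ x ∈ B, |laplace c χ x * V x| := Finset.abs_sum_le_sum_abs _ _
      _ ≤ ∑ x ∈ B, 27 * c ^ 2 / (n₁ : ℝ) ^ 2 * |V x| := Finset.sum_le_sum fun x _ => by
          rw [abs_mul]; exact mul_le_mul_of_nonneg_right (hlap x) (abs_nonneg _)
      _ = 27 * c ^ 2 / (n₁ : ℝ) ^ 2 * ∑ x ∈ B, |V x| := by rw [Finset.mul_sum]
      _ ≤ 27 * c ^ 2 / (n₁ : ℝ) ^ 2 * (Real.sqrt (B.card : ℝ) * Real.sqrt (∑ x ∈ B, V x ^ 2)) :=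
          mul_le_mul_of_nonneg_left hCS (by positivity)
      _ ≤ 27 * c ^ 2 / (n₁ : ℝ) ^ 2 * (Real.sqrt (216 * ℓ ^ 3) * Real.sqrt (CV * ℓ ^ 3 * M ^ 2)) :=
          mul_le_mul_of_nonneg_left (mul_le_mul (Real.sqrt_le_sqrt hcardB) (Real.sqrt_le_sqrt hVB) (Real.sqrt_nonneg _)
            (Real.sqrt_nonneg _)) (by positivity)
  -- arithmetic: `√(216ℓ³)·√(C_Vℓ³M²) = √216·√C_V·ℓ³·M`, `ℓ³∕n₁² ≤ 158²·ℓ`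
  have hsq : Real.sqrt (216 * ℓ ^ 3) * Real.sqrt (CV * ℓ ^ 3 * M ^ 2) = Real.sqrt 216 * Real.sqrt CV * ℓ ^ 3 * M := by
    rw [← Real.sqrt_mul (by positivity), show 216 * ℓ ^ 3 * (CV * ℓ ^ 3 * M ^ 2) = (216 * CV) * (ℓ ^ 3 * M) ^ 2 by ring,
      Real.sqrt_mul (by positivity), Real.sqrt_sq (by positivity), Real.sqrt_mul (by norm_num)]
    ring
  rw [hsq] at hbound
  refine hbound.trans ?_
  have hkey : ℓ ^ 3 / (n₁ : ℝ) ^ 2 ≤ 158 ^ 2 * ℓ := by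
    rw [div_le_iff₀ (by positivity)]
    have : ℓ ^ 2 ≤ (158 * (n₁ : ℝ)) ^ 2 := pow_le_pow_left₀ (by positivity) h158ℓ 2
    nlinarith
  have h0 : 0 ≤ 27 * c ^ 2 * (Real.sqrt 216 * Real.sqrt CV) * M := by positivity
  calc 27 * c ^ 2 / (n₁ : ℝ) ^ 2 * (Real.sqrt 216 * Real.sqrt CV * ℓ ^ 3 * M)
      = 27 * c ^ 2 * (Real.sqrt 216 * Real.sqrt CV) * M * (ℓ ^ 3 / (n₁ : ℝ) ^ 2) := by ring
    _ ≤ 27 * c ^ 2 * (Real.sqrt 216 * Real.sqrt CV) * M * (158 ^ 2 * ℓ) := mul_le_mul_of_nonneg_left hkey h0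
    _ = 27 * Real.sqrt 216 * Real.sqrt CV * 158 ^ 2 * c ^ 2 * ℓ * M := by ring


end Summit.QuantumFields.YangMills.Theorems.Prop7InterpErrorPinReaction

end
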